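import Literature.AnabelianGeometry.AbsoluteAnabelian.AbsTopIII.FrobeniusPictureMLFTelecoreCountermodel
import Literature.AnabelianGeometry.AbsoluteAnabelian.AbsTopIII.FrobeniusPictureMLFModel
import Literature.AnabelianGeometry.AbsoluteAnabelian.AbsTopIII.LogFrobeniusToyWitness
import Literature.AnabelianGeometry.AbsoluteAnabelian.AbsTopIII.AutHolLogFrobeniusGaloisModel
import HarnessLib

/-!
# [AbsTopIII] Cor. 3.6 (ii) `TelecoreStmt` and Cor. 3.6 (i)–(v) `LogFrobeniusCompatible`: schema verdicts

S. Mochizuki, *Topics in Absolute Anabelian Geometry III*, Cor. 3.6 pp. 78–82 (kurims manuscript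
`paper:url-5493eb38cbb7`; bib key `MochizukiAbsTopIII2015`).  PROOF-ONLY companion of
`FrobeniusPictureMLFTelecore.lean` (abc-iut cell, block F fact-proving wave, seat abc-iut-f-082,
FACT-LIST rows **F-0363** `LogFrobeniusData.TelecoreStmt` and **F-2425**
`LogFrobeniusData.LogFrobeniusCompatible`); no notion is declared, no statement file is touched.

Both rows are SCHEMATA over the abstract input record `Δ : LogFrobeniusData` (six categories and the
functors / natural transformations of the diagram `𝒟` of Cor. 3.6) and first-row telecore data
`τ : Δ.TelecoreData`.  FACT-LIST rule R5: the universal closure of such a schema is not a fact; what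
counts is (a) whether the closure is refutable in the kernel and (b) the instance forms the tree proves.
This file records both, by TERMS OF THE TREE (nothing is re-proved):

* `LogFrobeniusData.not_forall_telecoreStmt` — **F-0363: the universal closure
  `∀ Δ τ, Δ.TelecoreStmt τ` is REFUTED** (seat abc-iut-w5-d061's `AbsTopIII.exists_not_telecoreStmt`:
  one-object groupoid of `ℤ/2`, identification `e` twisted by the central element `g ≠ 1`; the
  coherence `telecoreStmt_iff_coherent` forces `1 = g`).
* `LogFrobeniusData.exists_telecoreStmt` — **F-0363 instance form PROVED**: at Def.-3.1-shaped
  inputs the statement holds outright (`MonoAnabelianLogFrobeniusData.telecoreStmt`, seat abc-iut-L4-t5;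
  here instantiated at the cell's MLF-Galois `TF`-model `TFModel.monoAnabelianData`, p = 2, at the
  formally satisfiable anabelian input `TFModel.AnabelianInput.ofEmpty`), and at every `Δ` with fully
  faithful `id_⋎` exactly for the coherent `τ` (`LogFrobeniusData.telecoreStmt_iff_coherent`).
* `LogFrobeniusData.not_forall_logFrobeniusCompatible` — **F-2425: the universal closure
  `∀ Δ τ, Δ.LogFrobeniusCompatible τ` is REFUTED** (its field `telecore` is `TelecoreStmt τ`).
* `LogFrobeniusData.exists_logFrobeniusCompatible` /
  `LogFrobeniusData.exists_logFrobeniusCompatible_arch` — **F-2425 instance forms PROVED**: in MLF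
  orientation (`ι_× : λ^× → λ^{×pf}`) at seat abc-iut-w5-d210's witness
  `AbsTopIII.cor_3_6_hypotheses_satisfiable`; in Aut-holomorphic orientation OUTRIGHT at the
  Galois-category instance `Π := G_{ℚ_p}` of the archimedean model
  (`AbsTopIII.cor_4_5_arch_absoluteGaloisGroup_padic`, Cor. 4.5 = the same structure); at the MLF-Galois
  `TF`-model the assembled statement is `TFModel.logFrobeniusCompatible_model`, conditional on exactly a
  slim type `P`, a Cor-1.10 datum and an object (Lemma 3.4 and Prop. 3.2 (iv) discharged there).
* `LogFrobeniusData.telecoreStmt_schema_verdict`, `LogFrobeniusData.logFrobeniusCompatible_schema_verdict`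
  — the two conjunctions «closure refuted ∧ instance inhabited» for the FACT-LIST fold.

HONEST FRAMING: refereed pre-IUT material ([AbsTopIII] is category theory over its Def. 3.1 /
Cor. 1.10 data); a FACT row is an assumption label, not an endorsement; nothing here bears on
[IUTchIII] Cor. 3.12 or takes a side; typed ≠ proved except for the theorems cited.
-/

namespace Literature.AnabelianGeometry.AbsoluteAnabelian

open _root_.CategoryTheory

namespace LogFrobeniusData

/-! ### F-0363: `TelecoreStmt` (Cor. 3.6 (ii)) -/

/-- **FACT-LIST F-0363 — universal closure REFUTED.**  It is not the case that the typed Cor. 3.6 (ii)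
`TelecoreStmt τ` holds for every abstract log-Frobenius datum `Δ` and every first-row telecore datum
`τ`: seat abc-iut-w5-d061's countermodel `AbsTopIII.exists_not_telecoreStmt` (incoherent `τ` over the
one-object groupoid of `ℤ/2`). [cite: MochizukiAbsTopIII2015, Corollary 3.6 (ii) pp.79–80] -/
theorem not_forall_telecoreStmt :
    ¬ ∀ (Δ : LogFrobeniusData.{0}) (τ : Δ.TelecoreData),
      Literature.AnabelianGeometry.AbsoluteAnabelian.LogFrobeniusData.TelecoreStmt Δ τ := by
  intro h
  obtain ⟨Δ, τ, -, hΔ⟩ := AbsTopIII.exists_not_telecoreStmt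
  exact hΔ (h Δ τ)

/-- **FACT-LIST F-0363 — instance form PROVED** (the printed shape of the data): for the
`LogFrobeniusData` built from Def.-3.1-shaped inputs with the printed telecore datum `⟨φ_An, 𝟙, η_An⟩`
the statement holds outright (`MonoAnabelianLogFrobeniusData.telecoreStmt`); instantiated here at the
cell's MLF-Galois `TF`-model (`TFModel.monoAnabelianData`, `p = 2`, empty type `P := fun _ => False` with its formal
anabelian input `TFModel.AnabelianInput.ofEmpty`), so the schema is inhabited in the kernel.
[cite: MochizukiAbsTopIII2015, Corollary 3.6 (ii) pp.79–80] -/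
theorem exists_telecoreStmt :
    ∃ (Δ : LogFrobeniusData.{1}) (τ : Δ.TelecoreData),
      Literature.AnabelianGeometry.AbsoluteAnabelian.LogFrobeniusData.TelecoreStmt Δ τ := by
  haveI : Fact (Nat.Prime 2) := ⟨Nat.prime_two⟩
  exact ⟨_, _, AbsTopIII.TFModel.telecoreStmt_model
    (AbsTopIII.TFModel.AnabelianInput.ofEmpty (p := 2) (P := fun _ => False) fun _ h => h)⟩

/-- **F-0363 schema verdict** for the FACT-LIST fold: the universal closure of `TelecoreStmt` is
refuted AND the schema is inhabited (instance form proved); the exact dividing line is coherence of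
`τ` (`telecoreStmt_iff_coherent`). [cite: MochizukiAbsTopIII2015, Corollary 3.6 (ii) pp.79–80] -/
theorem telecoreStmt_schema_verdict :
    (¬ ∀ (Δ : LogFrobeniusData.{0}) (τ : Δ.TelecoreData), Δ.TelecoreStmt τ) ∧
      (∃ (Δ : LogFrobeniusData.{1}) (τ : Δ.TelecoreData), Δ.TelecoreStmt τ) :=
  ⟨not_forall_telecoreStmt, exists_telecoreStmt⟩

/-! ### F-2425: `LogFrobeniusCompatible` (Cor. 3.6 (i)–(v) assembled) -/

/-- There is an abstract log-Frobenius datum with fully faithful `id_⋎` and a telecore datum at which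
the assembled Cor. 3.6 `LogFrobeniusCompatible` FAILS (its item (ii) `telecore` fails:
`AbsTopIII.exists_not_telecoreStmt`). [cite: MochizukiAbsTopIII2015, Corollary 3.6 (i)–(v) pp.78–80] -/
theorem exists_not_logFrobeniusCompatible :
    ∃ (Δ : LogFrobeniusData.{0}) (τ : Δ.TelecoreData),
      Nonempty Δ.toNexus.FullyFaithful ∧
        ¬ Literature.AnabelianGeometry.AbsoluteAnabelian.LogFrobeniusData.LogFrobeniusCompatible Δ τ := by
  obtain ⟨Δ, τ, hff, hΔ⟩ := AbsTopIII.exists_not_telecoreStmt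
  exact ⟨Δ, τ, hff, fun h => hΔ h.telecore⟩

/-- **FACT-LIST F-2425 — universal closure REFUTED.**  It is not the case that the assembled typed
Cor. 3.6 (i)–(v) `LogFrobeniusCompatible τ` holds for every `Δ` and `τ`.
[cite: MochizukiAbsTopIII2015, Corollary 3.6 (i)–(v) pp.78–80] -/
theorem not_forall_logFrobeniusCompatible :
    ¬ ∀ (Δ : LogFrobeniusData.{0}) (τ : Δ.TelecoreData),
      Literature.AnabelianGeometry.AbsoluteAnabelian.LogFrobeniusData.LogFrobeniusCompatible Δ τ := by
  intro h
  obtain ⟨Δ, τ, -, hΔ⟩ := exists_not_logFrobeniusCompatible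
  exact hΔ (h Δ τ)

/-- **FACT-LIST F-2425 — instance form PROVED, MLF orientation** (`ι_× : λ^× → λ^{×pf}`, §3): the
assembled Cor. 3.6 holds at seat abc-iut-w5-d210's witness datum (`AbsTopIII.cor_3_6_hypotheses_satisfiable`:
the hypotheses of `LogFrobeniusData.logFrobeniusCompatible_of` — Lemma-3.4 property, total rigidity of
`𝒟_{≤□}`, fully faithful `id_⋎`, coherent `τ`, a first-row object — jointly hold there).
[cite: MochizukiAbsTopIII2015, Corollary 3.6 (i)–(v) pp.78–80] -/
theorem exists_logFrobeniusCompatible :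
    ∃ (Δ : LogFrobeniusData.{0}) (τ : Δ.TelecoreData),
      Literature.AnabelianGeometry.AbsoluteAnabelian.LogFrobeniusData.LogFrobeniusCompatible Δ τ := by
  obtain ⟨Δ, τ, _, _, -, -, -, -, -, h⟩ := AbsTopIII.cor_3_6_hypotheses_satisfiable
  exact ⟨Δ, τ, h⟩

/-- **FACT-LIST F-2425 — instance form PROVED OUTRIGHT at a Galois model** (Aut-holomorphic orientation,
Cor. 4.5 = literally the same structure, `AbsTopIII.Cor_4_5 Δ τ := Δ.LogFrobeniusCompatible τ`): the
archimedean log-Frobenius data over the Galois category of `Π := G_{ℚ_2}` (slim by [pGC] Lemma 15.8,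
proved in the tree) satisfy Cor. 3.6/4.5 (i)–(v) as typed
(`AbsTopIII.cor_4_5_arch_absoluteGaloisGroup_padic`). [cite: MochizukiAbsTopIII2015, Corollary 4.5 pp.107–109] -/
theorem exists_logFrobeniusCompatible_arch :
    ∃ (Δ : LogFrobeniusData.{1}) (τ : Δ.TelecoreData),
      Literature.AnabelianGeometry.AbsoluteAnabelian.LogFrobeniusData.LogFrobeniusCompatible Δ τ := by
  haveI : Fact (Nat.Prime 2) := ⟨Nat.prime_two⟩
  exact ⟨_, _, AbsTopIII.cor_4_5_arch_absoluteGaloisGroup_padic 2⟩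

/-- **F-2425 schema verdict** for the FACT-LIST fold: the universal closure of `LogFrobeniusCompatible`
is refuted AND the schema is inhabited in both orientations (MLF: toy witness datum; Aut-holomorphic:
the Galois model of `G_{ℚ_2}` outright); at the MLF-Galois `TF`-model it is
`TFModel.logFrobeniusCompatible_model` (conditional on a slim type, a Cor-1.10 datum, an object).
[cite: MochizukiAbsTopIII2015, Corollary 3.6 (i)–(v) pp.78–80] -/
theorem logFrobeniusCompatible_schema_verdict :
    (¬ ∀ (Δ : LogFrobeniusData.{0}) (τ : Δ.TelecoreData), Δ.LogFrobeniusCompatible τ) ∧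
      (∃ (Δ : LogFrobeniusData.{0}) (τ : Δ.TelecoreData), Δ.LogFrobeniusCompatible τ) ∧
      (∃ (Δ : LogFrobeniusData.{1}) (τ : Δ.TelecoreData), Δ.LogFrobeniusCompatible τ) :=
  ⟨not_forall_logFrobeniusCompatible, exists_logFrobeniusCompatible, exists_logFrobeniusCompatible_arch⟩

end LogFrobeniusData

end Literature.AnabelianGeometry.AbsoluteAnabelian
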